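/-
Copyright (c) 2026 the pub-hodgecm-mathlib formalisation cell (harness21).  Prover seat hodgecm-mathlib-K2E1b-p08 (g0), Track B ∕ K2-LIT
(build stream 29), h413 = `stmt-HodgeConjecture-24833`, line `K2_E1b_GKCohomologyU21`, assembly file #20 — the payment of the tier-0 CONSTRUCTION stub
`K2E1bGKCohomologyU21.stub_jTable` «J-TABLE» TOKEN FOR TOKEN.  2026-09-03.
-/
import Summits.HodgeConjecture.HodgeConjecture.Theorems.K2E1bGKCohomologyU21Defs
import Summits.HodgeConjecture.HodgeConjecture.Theorems.K2E1bKTypeTwistDefs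
import Summits.HodgeConjecture.HodgeConjecture.Theorems.K2E1bJDatum                 -- ★ #11 `jDatum` (K2E1b-p09)
import Summits.HodgeConjecture.HodgeConjecture.Theorems.K2E1bDatumCohUnitaryIrrep    -- ★ #10 `DatumCohUnitaryIrrep` (K2E1b-p08)
import Summits.HodgeConjecture.HodgeConjecture.Theorems.F0P3bArchDegOnePackageDefs
import Literature.RepresentationTheory.BorelWallach2000.UpqCasimirTensor
import Literature.RepresentationTheory.Kovacevic2021.SU21Unitarity
import HarnessLib

/-!
# h413 ∕ Track B «K2-LIT», line `K2_E1b_GKCohomologyU21`, assembly file #20 «J-CARRIER CLASS»: THE NON-TEMPERED HALF OF ROGAWSKI'S p. 178 TABLE EXISTS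
# (payment of `Cruxes/H413/Lines/K2_E1b_GKCohomologyU21.lean :: stub_jTable`, statement bytes frozen)

Cell `pub/hodgecm-mathlib`, crux H413 = `stmt-HodgeConjecture-24833`, route of record `HCCMUnconditional`; chair K2-lead (g0), dealer K2E1b-plan (g0)
(DEAL BY NAME 21:08:09Z: «#20 `Theorems/K2E1bJCarrierClass.lean` … the moment #10 + #11 are ★»).  THEOREMS ONLY; lane `--supports stmt-HodgeConjecture-24833 --as helper`.

THE STATEMENT (bytes of the stub).  `∃ jInf : ℤ → ℤ → ℤ → GKIrrClass U(2,1), ∀ p q t, IsChiPinnedCohUnitary (jInf p q t) (casimirExp p q t) (centralExp p q t)`: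
a family of equivalence classes of irreducible admissible `(𝔲(2,1), K)`-modules unitary along `𝔭 ⊕ ℝz₀` whose χ-scalars are Rogawski's
`κ(φ) = a² + b² + c² − 2` and `e(φ) = a + b + c`, `φ = (a, b, c) = rogTriple p q t` (★ leaf `Theorems/K2E1bGKCohomologyU21Defs`).

THE PROOF (strategy: ASSEMBLY — the dealer's kernel-checked docking cert `K2/K2E1b-plan/g0/K2E1bJCarrierClass.cand.K2E1b-plan-g0.lean` ed245b604af2dd55
with the hypotheses paid).  §1 `jCarrierClass_of` is the sorry-free GLUE: from socket #11 `U23.sig_K2E1bJDatum` (for every `φ` an irreducible unitarizable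
Kovačević datum `𝒬` with `6 ∣ m − 3n + 3 + 2e(φ)` on its `K`-types and trace-form Casimir `κ(φ) − e(φ)²∕3`) and socket #10 `U0.sig_K2E1bDatumCohUnitaryIrrep`
(the per-datum packaging: twisted `K`-action, `IsCohUnitaryIrrep`, χ-scalars `(κ₀ + e²∕3, e)`), both with statement bytes VERBATIM, it builds for each
`(p, q, t)` a ★ `GKIrrep` representative and takes its class (`GKIrrClass.mk`, `choose`); the χ-currency `κ₀ + e²∕3 = κ(φ)`, `e = e(φ)` is reconciled by
`push_cast; ring`.  §2 `JCarrierClass` = the stub BY NAME, the glue applied to the landed ★ `Theorems/K2E1bJDatum` (#11) and ★ `Theorems/K2E1bDatumCohUnitaryIrrep` (#10).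

HONEST LABEL.  HC_CM is proved only modulo the 7 printed citations (2 remaining named inputs: hLiu418 = `stmt-HodgeConjecture-24832`, h413 =
`stmt-HodgeConjecture-24833`) until rung 0 closes; this file pays ONE of the three tier-0 stubs of the line (the letter `ArchClausesLetter` needs all three).

## References
* [Rogawski1990] J. Rogawski, *Automorphic representations of unitary groups in three variables*, Ann. of Math. Stud. 123 (1990), §12.3 pp. 176–178
  (`J^±_φ`, the Langlands quotients of `i_G(χ_φ^±)`, unitary iff `n = 1` resp. `m = 1`), Prop. 13.8.1 p. 206.
* [Kovacevic2021] D. Kovačević, *Unitary `(𝔤, K)`-modules of `SU(2,1)`* (2021) — §3 Thm. 3, §4 Thm. 4–5.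
* [BorelWallach2000] A. Borel, N. Wallach, *Continuous Cohomology, Discrete Subgroups, and Representations of Reductive Groups*, 2nd ed., AMS 2000 —
  VI 4.7–4.10, Thm. 4.12 (2).
-/

set_option autoImplicit false
-- the mandated namespace repeats the single-problem summit's segment (`HodgeConjecture.HodgeConjecture`)
set_option linter.dupNamespace false

noncomputable section

namespace Summit.HodgeConjecture.HodgeConjecture.Cruxes.H413.K2E1bJCarrierClass

open Literature.NumberTheory.Automorphic
open Literature.NumberTheory.Rogawski1990
open Literature.RepresentationTheory.BorelWallach2000
open Literature.RepresentationTheory.KonnoKonno2007 Literature.RepresentationTheory.KonnoKonno2007.RealDualPair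
open Literature.RepresentationTheory.KonnoKonno2007.RealDualPair.UForm
open Literature.RepresentationTheory.Kovacevic2021 Literature.RepresentationTheory.Kovacevic2021.SU21Datum
open Summit.HodgeConjecture.HodgeConjecture.Cruxes.H413.F0P3bLocalAPacketsDefs
open Summit.HodgeConjecture.HodgeConjecture.Cruxes.H413.F0P3bArchDegOnePackage (IsCohUnitaryIrrep)
open Summit.HodgeConjecture.HodgeConjecture.Cruxes.H413.K2E1bGKCohomologyU21

-- Mathlib idiom (as in `GKModules`, the `Upq*` files, the Kovačević topic, the defs leaves and the line): commutator bracket on `Module.End` ∕ matrices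
attribute [local instance 100] LieRing.ofAssociativeRing

/-! ## §1 The glue: «J-TABLE» from sockets #11 and #10 (statement bytes VERBATIM as hypotheses) -/

/-- **GLUE (assembly node «J-TABLE»).**  From socket #11 (`sig_K2E1bJDatum`: for every `φ = rogTriple p q t = (a,b,c)` an irreducible unitarizable
Kovačević datum with `6 ∣ m − 3n + 3 + 2(a+b+c)` on its `K`-types and trace-form Casimir `(a²+b²+c²−2) − (a+b+c)²∕3`) and socket #10
(`sig_K2E1bDatumCohUnitaryIrrep`: the per-datum packaging with χ-scalars `(κ₀ + e²∕3, e)`), a family of classes `jInf p q t` pinned in χ-currency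
at `(casimirExp p q t, centralExp p q t)` — representative `⟨𝒬.V, ρK, σ⟩ : GKIrrep U(2,1)`, class `GKIrrClass.mk`, scalars reconciled by `push_cast; ring`.
(The dealer's docking cert ed245b604af2dd55, hypotheses paid by name in §2.) [cite: Rogawski1990, §12.3 pp. 176–178] [cite: Kovacevic2021, §3 Thm. 3; §4 Thm. 4–5] -/
theorem jCarrierClass_of
    (h11 : ∀ (p q t a b c : ℤ), ArchSignRecipe.rogTriple p q t = (a, b, c) →
      ∃ 𝒬 : SU21Datum, LieModule.IsIrreducible ℂ (Matrix (Fin 3) (Fin 3) ℂ) 𝒬.V ∧ IsUnitarizable 𝒬 ∧ 𝒬.S.Infinite ∧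
        (∀ n m : ℤ, (n, m) ∈ 𝒬.S → (6 : ℤ) ∣ m - 3 * n + 3 + 2 * (a + b + c)) ∧
        ∀ v : 𝒬.V, (∑ i : Fin 3, ∑ j : Fin 3, ⁅E i j, ⁅E j i, v⁆⁆) =
          ((((a ^ 2 + b ^ 2 + c ^ 2 - 2 : ℤ) : ℂ)) - (((a + b + c : ℤ) : ℂ)) ^ 2 / 3) • v)
    (h10 : ∀ (𝒟 : SU21Datum) (e : ℤ) (κ₀ : ℂ), LieModule.IsIrreducible ℂ (Matrix (Fin 3) (Fin 3) ℂ) 𝒟.V → IsUnitarizable 𝒟 →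
      (∀ v : 𝒟.V, (∑ i : Fin 3, ∑ j : Fin 3, ⁅E i j, ⁅E j i, v⁆⁆) = κ₀ • v) →
      (∀ n m : ℤ, (n, m) ∈ 𝒟.S → (6 : ℤ) ∣ m - 3 * n + 3 + 2 * e) →
        ∃ (ρK : Representation ℂ G21.maximalCompact 𝒟.V) (σ : G21.lie →ₗ⁅ℝ⁆ Module.End ℂ 𝒟.V),
          IsTwistOf 𝒟.ρ ((e : ℂ) / 3) σ ∧ IsCohUnitaryIrrep ρK σ ∧
            (∀ v : 𝒟.V, upqCasimirOp σ v = (κ₀ + (e : ℂ) ^ 2 / 3) • v) ∧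
              ∀ Z : G21.lie, (Z : Matrix (Fin 2 ⊕ Fin 1) (Fin 2 ⊕ Fin 1) ℂ) = Complex.I • (1 : Matrix (Fin 2 ⊕ Fin 1) (Fin 2 ⊕ Fin 1) ℂ) →
                ∀ v : 𝒟.V, σ Z v = ((e : ℂ) * Complex.I) • v) :
    ∃ jInf : ℤ → ℤ → ℤ → GKIrrClass (uFormGroup (Fin 2) (Fin 1)),
      ∀ p q t : ℤ, IsChiPinnedCohUnitary (jInf p q t) (casimirExp p q t) (centralExp p q t) := by
  -- for every `(p, q, t)`: a representative `GKIrrep` with the χ-scalars of print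
  have key : ∀ p q t : ℤ, ∃ r : GKIrrep G21,
      IsCohUnitaryIrrep r.ρK r.ρ𝔤 ∧ HasChiScalars r.ρ𝔤 (casimirExp p q t) (centralExp p q t) := by
    intro p q t
    obtain ⟨⟨a, b, c⟩, habc⟩ : ∃ abc : ℤ × ℤ × ℤ, ArchSignRecipe.rogTriple p q t = abc := ⟨_, rfl⟩
    -- #11: the Kovačević datum of `J^{±}_φ`; #10: its twisted `(𝔤, K)`-packaging with χ-scalars `(κ₀ + e²∕3, e)`, `e = a + b + c`
    obtain ⟨𝒬, hirr, hunit, -, hint, hcas⟩ := h11 p q t a b c habc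
    obtain ⟨ρK, σ, -, hcu, hC, hZ⟩ := h10 𝒬 (a + b + c) _ hirr hunit hcas hint
    refine ⟨⟨𝒬.V, ρK, σ, hcu.gk, hcu.irred⟩, hcu, ?_, ?_⟩
    · -- Casimir: `(κ(φ) − e²∕3) + e²∕3 = κ(φ)`
      intro v
      rw [hC v]
      congr 1
      simp only [casimirExp, habc]
      push_cast
      ring
    · -- centre: `e = a + b + c = centralExp p q t`
      intro Z hZ' v
      rw [hZ Z hZ' v]
      congr 1
      simp only [centralExp, habc]
  choose r hr using key
  exact ⟨fun p q t => GKIrrClass.mk (r p q t), fun p q t => ⟨r p q t, rfl, (hr p q t).1, (hr p q t).2⟩⟩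

/-! ## §2 The stub «J-TABLE» BY NAME (the glue applied to the landed ★ #11 and ★ #10) -/

/-- **Tier-0 CONSTRUCTION stub `K2E1bGKCohomologyU21.stub_jTable` «J-TABLE» of `Cruxes/H413/Lines/K2_E1b_GKCohomologyU21.lean` (statement bytes frozen).**
The non-tempered half of Rogawski's p. 178 table at `∞` exists in χ-currency: a family `jInf : ℤ³ → GKIrrClass U(2,1)` of classes of irreducible
admissible `(𝔲(2,1), K)`-modules unitary along `𝔭 ⊕ ℝz₀` with χ-scalars `(κ(φ), e(φ))` = (`casimirExp p q t`, `centralExp p q t`) — in print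
`J^{rogSign p t}_φ`; here the twisted Kovačević ray module of ★ `K2E1bJDatum.jDatum` packaged by ★ `K2E1bDatumCohUnitaryIrrep.DatumCohUnitaryIrrep`.
Proof: `jCarrierClass_of` at those two theorems — one term, no tactic.
[cite: Rogawski1990, §12.3 pp. 176–178] [cite: Kovacevic2021, §3 Thm. 3; §4 Thm. 4–5] [cite: BorelWallach2000, VI 4.7–4.10; Thm. 4.12 (2)] -/
theorem JCarrierClass :
    ∃ jInf : ℤ → ℤ → ℤ → GKIrrClass (uFormGroup (Fin 2) (Fin 1)),
      ∀ p q t : ℤ, IsChiPinnedCohUnitary (jInf p q t) (casimirExp p q t) (centralExp p q t) :=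
  jCarrierClass_of K2E1bJDatum.jDatum K2E1bDatumCohUnitaryIrrep.DatumCohUnitaryIrrep

end Summit.HodgeConjecture.HodgeConjecture.Cruxes.H413.K2E1bJCarrierClass

end
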